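import Literature.Probability.LatticeModels.PlanarIsingFreeTwoPointJordan
import Literature.Probability.LatticeModels.PlanarIsingOnePointSpinorForm
import Literature.Probability.RandomPlanarGeometry.JordanDomainProofs
import Literature.Probability.LatticeModels.MeshDomainJordan
import Literature.Probability.LatticeModels.GriffithsMonotonicity
import Literature.Probability.LatticeModels.GKSInequalities
import Literature.Probability.RandomPlanarGeometry.CaratheodoryKernelPointwise
import Literature.Probability.LatticeModels.JordanPolyominoApproximants
import Literature.Probability.LatticeModels.PlanarIsingOnePointSplit
import HarnessLib

/-!
# CHI Theorem 1.1 (free boundary conditions) on Jordan domains: what the tree's CHI chain gives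

Companion to `PlanarIsingFreeTwoPointJordan.lean`, which vendors the named fact
`Literature.Probability.LatticeModels.chi_twoPoint_free_jordan` (Chelkak–Hongler–Izyurov,
*Conformal invariance of spin correlations in the planar Ising model*, Ann. of Math. 181 (2015)
= arXiv:1202.2838 (CHI), Thm. 1.1, free boundary conditions, `ϱ`-normalised, for the tree's
canonical discretisation of a Jordan domain with ALL sites of `Ω_δ = meshDomainFinset Ω δ` free).

In the source the free case of Thm. 1.1 is the last paragraph of §2.9 (p. 19 of the arXiv
version): `𝔼^free_{Ω^•_δ-δ}[σ_aσ_b] ∼ 𝓑_Ω(a;b) 𝔼⁺_{Ω_δ}[σ_aσ_b] ∼ ϱ(δ) 𝓑_Ω(a;b) ⟨σ_aσ_b⟩⁺_Ω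
= ϱ(δ) ⟨σ_aσ_b⟩^free_Ω`, i.e. Thm. 1.7 (`𝓑_Ω`, the free/`+` ratio) times the `+` case, itself
assembled in §2.9 from Prop. 2.20 (ratios inside one domain; from Thm. 1.5 and Remark 2.18) and
Thm. 1.7 again (Lemma 2.24). The tree PROVES this whole assembly
(`chi_twoPoint_rho_of_spinorCoefficient`, files `PlanarIsingTwoPointProofs`, `LatticeRatioLimit`,
`PlanarIsingOnePointSpinorForm`) and holds the three deep inputs — the outputs of CHI's discrete
spinor analysis, §§2.4–2.6 and §3 — as the (unproved) named facts
`chi_plusTwoPoint_diagLogDerivative` (Thm. 1.5, `k = 1`), `chi_plusTwoPoint_nnRatio` (Remark 2.18)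
and `chi_freePlusTwoPoint_ratio` (Thm. 1.7) of `PlanarIsingOnePointSplit.lean`, all for bounded
simply connected `Ω` whose discretisations approximate `Ω` (`MeshApproximates Ω`) and for the free
model on the interior sites `meshInteriorFinset Ω δ` (`meshIsingFreeCorr`; CHI p. 19: "the fact that
we have `Ω^•_δ - δ` instead of `Ω_δ` plays no role").

This file records, sorry-free and WITHOUT new named facts, exactly how far that chain reaches
towards `chi_twoPoint_free_jordan`:

* `JordanDomain.isAdmissibleDomain_carrier` — a Jordan domain of the tree is an admissible domain
  (`IsAdmissibleDomain`: open, bounded, nonempty, simply connected — the last by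
  `JordanDomain.isSimplyConnected_carrier`, Conway VIII.2.2);
* `tendsto_meshIsingFreeCorr_div_rhoCHI_jordan_of_CHI` — **CHI Thm. 1.1, free boundary
  conditions, `ϱ`-normalised, pointwise, for a Jordan domain whose discretisations approximate it**
  (`MeshApproximates Ω.carrier`), for the free model on the interior sites, from the three children
  (taken, as in `chi_twoPoint_rho_of_spinorCoefficient`, as hypotheses verbatim equal to the named
  facts, which therefore discharge them by unfolding);
* `meshIsingFreeCorr_two_le_isingTwoPoint_meshDomainFinset` — Griffiths' second inequality in the
  volume (Friedli–Velenik, Exercise 3.12): freeing the boundary layer `∂Ω_δ` as well (the volume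
  `meshDomainFinset Ω δ` of `chi_twoPoint_free_jordan`, same graph `Ω_δ`) can only increase the
  free two-point function;
* `chi_twoPoint_free_jordan_lowerHalf_of_CHI` — hence the LOWER half of
  `chi_twoPoint_free_jordan` for approximable Jordan domains, conditionally on the three children:
  `liminf_{δ→0⁺} 𝔼^free_{Ω_δ, all sites free}[σ_zσ_w] / ϱ(δ) ≥ ⟨σ_zσ_w⟩^free_Ω` (in `ε`-form).

* `eventually_meshIsingFreeCorr_inner_le`, `eventually_le_meshIsingFreeCorr_outer` — the
  **lattice sandwich** of CHI §2.9 for the fact's model on an ARBITRARY Jordan domain `Ω`: by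
  Griffiths' second inequality in the volume and in the couplings
  (`isingCorr_free_le_of_subset`, `isingCorr_free_mono_graph`), eventually
  `𝔼^free_{(Ω₀)_δ, interior}[σ_zσ_w] ≤ 𝔼^free_{Ω_δ, all sites}[σ_zσ_w] ≤ 𝔼^free_{Ω'_δ, interior}[σ_zσ_w]`
  for an inner domain `Ω₀` (`closure Ω₀ ⊆ Ω`) and an outer domain `Ω' ⊇ closure Ω` whose
  discretisations approximate them; the geometric input — the marked sites and all sites of
  `(Ω₀)_δ` lie in the LARGEST component `meshDomain Ω δ` for small `δ` — is the tree's theorem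
  "the largest mesh component of a Jordan domain is the bulk"
  (`JordanDomain.eventually_forall_mem_meshDomain'`, `MeshDomainJordan.lean`; every Jordan domain,
  Osgood curves included);
* `JordanDomain.tendsto_isingTwoPoint_free_div_rhoCHI_of_sandwich`,
  `chi_twoPoint_free_jordan_of_interior_of_approximants` — the squeeze: **the named fact
  `chi_twoPoint_free_jordan` follows from CHI Thm. 1.1 (free) in the interior-volume form for all
  admissible approximable domains (the conclusion of `chi_twoPoint_rho_of_spinorCoefficient`, i.e.
  of the three children) together with the existence, for every Jordan `Ω`, distinct `z, w ∈ Ω`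
  and `ε > 0`, of admissible approximable inner and outer domains whose CHI two-point functions
  `⟨σ_zσ_w⟩^free` are `ε`-close to `⟨σ_zσ_w⟩^free_Ω`** (on paper: polygonal approximants,
  Carathéodory's kernel theorem (Pommerenke Thm. 1.8) and the covariance (1.2)).

* `tendsto_twoPointFreeCHI_of_tendsto`, `JordanDomain.eventually_exists_chart_close_of_kernel`
  — **transport of CHI's explicit function `⟨σ_zσ_w⟩^free` along kernel-convergent
  approximants**: if open simply connected `G_n ⊆ D̄(0, R)` contain `z` and converge to `Ω` in the
  kernel sense ((K1): compacts of `Ω` eventually inside; (K2): discs about points off `Ω`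
  eventually not inside), then for large `n` there is a conformal chart `ψ_n : G_n → ℍ` with
  `⟨σ_zσ_w⟩^free_{G_n}` (written through `ψ_n`) `ε`-close to `⟨σ_zσ_w⟩^free_Ω` (through `ψ`):
  take the Riemann maps `φ_n : G_n → 𝔻`, `φ : Ω → 𝔻` normalised at `z`; by the Carathéodory
  kernel theorem (`CaratheodoryKernel.tendsto_apply`, Pommerenke Thm. 1.8) `φ_n → φ` with
  derivatives at `z, w`; put `ψ_n = ψ ∘ φ⁻¹ ∘ φ_n`, and use the continuity of the explicit
  formula (1.2)–(1.3) in `(ψz, ψw, ψ'z, ψ'w)`.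

* `JordanDomain.exists_inner_outer_approximants_close` — **the approximation hypothesis
  `happrox` holds**, by feeding the polyomino approximants of `JordanPolyominoApproximants.lean`
  (`Polyomino.innerApprox Ω z aₙ ⋐ Ω`, `Polyomino.outerApprox Ω aₙ ⊇ Ω̄`, admissible and
  mesh-approximable, with the kernel hypotheses (K1), (K2)) into
  `eventually_exists_chart_close_of_kernel`;
* `chi_twoPoint_free_jordan_of_CHI`, `chi_twoPoint_free_jordan_of_facts` — **the named fact
  `chi_twoPoint_free_jordan` follows from CHI's three deep inputs** (the named facts
  `chi_plusTwoPoint_diagLogDerivative`, `chi_plusTwoPoint_nnRatio`, `chi_freePlusTwoPoint_ratio`: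
  Thm. 1.5 (`k = 1`), Remark 2.18, Thm. 1.7), unconditionally otherwise.

What is NOT reached here: the three children themselves (the discrete spinor analysis of CHI §3);
`chi_twoPoint_free_jordan_holds` is `chi_twoPoint_free_jordan_of_facts` applied to their
discharges.

## References

* D. Chelkak, C. Hongler, K. Izyurov, Ann. of Math. (2) 181 (2015) 1087–1138 = arXiv:1202.2838:
  Thm. 1.1, Thm. 1.5, Thm. 1.7, Remark 2.18, Prop. 2.20, §2.6 (approximation convention), §2.9
  (proof of Thm. 1.1, free case, p. 19). [ChelkakHonglerIzyurovAnnals2015]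
* S. Friedli, Y. Velenik, *Statistical Mechanics of Lattice Systems*, CUP (2017), Exercise 3.12
  (monotonicity of free correlations in the volume). [FriedliVelenik2017]
* J. B. Conway, *Functions of One Complex Variable I* (1978), Thm. VIII.2.2. [Conway1978]
-/

noncomputable section

open Filter Topology Metric Set
open Literature.Probability.LatticeModels Literature.Probability.RandomPlanarGeometry

namespace Literature.Probability.LatticeModels

/-! ### Jordan domains are admissible -/

/-- A Jordan domain of the tree (bounded connected open set bounded by a Jordan curve) is an
admissible domain in the sense of the CHI facts: open, bounded, nonempty and simply connected
(`JordanDomain.isSimplyConnected_carrier`, Conway VIII.2.2 (c) ⇒ (a)).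
[cite: Conway1978, Ch. VIII Thm. 2.2 ((c)⇒(a))] -/
theorem JordanDomain.isAdmissibleDomain_carrier (Ω : JordanDomain) : IsAdmissibleDomain Ω.carrier :=
  ⟨Ω.isOpen, Ω.isBounded, Ω.nonempty, Ω.isSimplyConnected_carrier⟩

/-! ### CHI Thm 1.1 (free), interior-volume form, for approximable Jordan domains -/

/-- **CHI Theorem 1.1, free boundary conditions, `ϱ`-normalised, pointwise, for a Jordan domain
whose discretisations approximate it**, from CHI Thm. 1.5 (`k = 1`), Remark 2.18 and Thm. 1.7 —
the hypotheses `h₁`, `h₂`, `h₃` are VERBATIM the bodies of the named facts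
`chi_plusTwoPoint_diagLogDerivative`, `chi_plusTwoPoint_nnRatio`, `chi_freePlusTwoPoint_ratio`
(`PlanarIsingOnePointSplit.lean`), so `(h : chi_…)` is accepted in their place by unfolding, as in
`chi_onePoint_rho_holds_of` there: for `Ω` Jordan with `MeshApproximates Ω`, a
conformal bijection `ψ : Ω → ℍ` and distinct `z, w ∈ Ω`,
`𝔼^free_{Ω_δ}[σ_zσ_w] / ϱ(δ) → ⟨σ_zσ_w⟩^free_Ω = ⟨σ_{ψz}σ_{ψw}⟩^free_ℍ |ψ'(z)|^{1/8} |ψ'(w)|^{1/8}`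
(`twoPointFreeCHI`), the free model being taken on the interior sites `meshInteriorFinset Ω δ`
(`meshIsingFreeCorr`), as in the sibling facts. This is the printed theorem (§2.9, p. 19:
"`𝔼^free ∼ 𝓑_Ω 𝔼⁺ ∼ ϱ(δ) ⟨σ_aσ_b⟩^free_Ω`") through the tree's proved assembly
`chi_twoPoint_rho_of_spinorCoefficient`.
[cite: ChelkakHonglerIzyurovAnnals2015, Thm. 1.1 (free boundary conditions) with eqs. (1.2)–(1.3); §2.9 p. 19; via Thm. 1.5, Remark 2.18, Thm. 1.7] -/
theorem tendsto_meshIsingFreeCorr_div_rhoCHI_jordan_of_CHI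
    (h₁ : ∀ (Ω : Set ℂ), IsAdmissibleDomain Ω → MeshApproximates Ω → ∀ (φ : ℂ → ℂ),
      IsConformalBijection φ Ω UpperHalfPlane.upperHalfPlaneSet → ∀ x ∈ Ω,
        ∀ K ⊆ Ω \ {x}, IsCompact K → ∀ s ∈ LatticeRatio.diagSteps, ∀ ε > (0 : ℝ), ∀ᶠ δ in 𝓝[>] (0 : ℝ),
          ∀ v : Site 2, meshPoint δ v ∈ K →
            |(meshIsingPlusCorr Ω δ ![x, meshPoint δ (v + s)] / meshIsingPlusCorr Ω δ ![x, meshPoint δ v] - 1) / δ -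
              (ACHI φ (meshPoint δ v) x * Site.toComplex s).re| < ε)
    (h₂ : ∀ (Ω : Set ℂ), IsAdmissibleDomain Ω → MeshApproximates Ω → ∀ (φ : ℂ → ℂ),
      IsConformalBijection φ Ω UpperHalfPlane.upperHalfPlaneSet → ∀ x ∈ Ω,
        ∀ K ⊆ Ω \ {x}, IsCompact K → ∀ s ∈ LatticeRatio.nnSteps, ∀ ε > (0 : ℝ), ∀ᶠ δ in 𝓝[>] (0 : ℝ),
          ∀ v : Site 2, meshPoint δ v ∈ K →
            |meshIsingPlusCorr Ω δ ![x, meshPoint δ (v + s)] / meshIsingPlusCorr Ω δ ![x, meshPoint δ v] - 1| < ε)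
    (h₃ : ∀ (Ω : Set ℂ), IsAdmissibleDomain Ω → MeshApproximates Ω → ∀ (φ : ℂ → ℂ),
      IsConformalBijection φ Ω UpperHalfPlane.upperHalfPlaneSet →
        ∀ x ∈ Ω, ∀ (y : ℝ → ℂ) (y₀ : ℂ), y₀ ∈ Ω → y₀ ≠ x → Tendsto y (𝓝[>] 0) (𝓝 y₀) →
          Tendsto (fun δ => meshIsingFreeCorr Ω δ ![x, y δ] / meshIsingPlusCorr Ω δ ![x, y δ])
            (𝓝[>] 0) (𝓝 (bCHI (φ x) (φ y₀))))
    (Ω : JordanDomain) (hM : MeshApproximates Ω.carrier) {ψ : ℂ → ℂ}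
    (hψ : IsConformalBijection ψ Ω.carrier UpperHalfPlane.upperHalfPlaneSet) {z w : ℂ}
    (hz : z ∈ Ω.carrier) (hw : w ∈ Ω.carrier) (hzw : z ≠ w) :
    Tendsto (fun δ : ℝ => meshIsingFreeCorr Ω.carrier δ ![z, w] / rhoCHI δ) (𝓝[>] 0)
      (𝓝 (twoPointFreeCHI ψ z w)) :=
  (chi_twoPoint_rho_of_spinorCoefficient h₁ h₂ h₃).2 Ω.carrier
    (JordanDomain.isAdmissibleDomain_carrier Ω) hM ψ hψ z hz w hw hzw

/-! ### Freeing the boundary layer: the GKS lower bound for the fact's own quotient -/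

/-- **Griffiths II in the volume, for the two free models on `Ω_δ`**: on the same graph
`Ω_δ = discreteDomainGraph Ω δ`, the free two-point function in the volume of ALL sites
`meshDomainFinset Ω δ` (the model of `chi_twoPoint_free_jordan`) dominates the one in the interior
volume `meshInteriorFinset Ω δ ⊆ meshDomainFinset Ω δ` (`meshIsingFreeCorr`), once both rounded
sites are interior and distinct (Friedli–Velenik, Exercise 3.12: `⟨σ_A⟩^∅_{Λ₁} ≤ ⟨σ_A⟩^∅_{Λ₂}` for
`A ⊆ Λ₁ ⊆ Λ₂`; CHI §2.9 use the same monotonicity, "by FKG").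
[cite: FriedliVelenik2017, Exercise 3.12, p. 112] -/
theorem meshIsingFreeCorr_two_le_isingTwoPoint_meshDomainFinset {Ω : Set ℂ} {δ : ℝ} {a c : ℂ}
    (ha : nearestSite δ a ∈ meshInteriorFinset Ω δ) (hc : nearestSite δ c ∈ meshInteriorFinset Ω δ)
    (h : nearestSite δ a ≠ nearestSite δ c) :
    meshIsingFreeCorr Ω δ ![a, c] ≤
      isingTwoPoint (discreteDomainGraph Ω δ) (meshDomainFinset Ω δ) criticalBetaTwo 0
        BoundaryCondition.free (nearestSite δ a) (nearestSite δ c) := by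
  -- `⟨σ_xσ_y⟩ = ⟨σ_{{x,y}}⟩` for the two distinct rounded sites (pair observable = set product).
  have hpair : isingTwoPoint (discreteDomainGraph Ω δ) (meshDomainFinset Ω δ) criticalBetaTwo 0
        BoundaryCondition.free (nearestSite δ a) (nearestSite δ c) =
      isingCorr (discreteDomainGraph Ω δ) (meshDomainFinset Ω δ) criticalBetaTwo 0
        BoundaryCondition.free {nearestSite δ a, nearestSite δ c} := by
    unfold isingTwoPoint isingCorr
    congr 1
    funext s
    simp [spinPair, spinProduct, Finset.prod_pair h]
  rw [meshIsingFreeCorr_two_eq Ω δ h, hpair]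
  refine isingCorr_free_le_of_subset (discreteDomainGraph Ω δ) criticalBetaTwo_pos.le le_rfl ?_
    (meshInteriorFinset_subset_meshDomainFinset Ω δ)
  intro x hx
  simp only [Finset.mem_insert, Finset.mem_singleton] at hx
  rcases hx with rfl | rfl
  · exact ha
  · exact hc

/-- For an approximable domain and distinct marked points, eventually (as `δ → 0⁺`) the quotient of
`chi_twoPoint_free_jordan` (all sites of `Ω_δ` free) is at least the interior-volume quotient
`𝔼^free_{Ω_δ}[σ_zσ_w] / ϱ(δ)` of the sibling CHI facts (GKS II, once the marked points are interior
sites rounding to distinct sites). [cite: FriedliVelenik2017, Exercise 3.12, p. 112] -/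
theorem eventually_meshIsingFreeCorr_div_le_of_meshApproximates {Ω : Set ℂ} (hM : MeshApproximates Ω)
    {z w : ℂ} (hz : z ∈ Ω) (hw : w ∈ Ω) (hzw : z ≠ w) :
    ∀ᶠ δ in 𝓝[>] (0 : ℝ), meshIsingFreeCorr Ω δ ![z, w] / rhoCHI δ ≤
      isingTwoPoint (discreteDomainGraph Ω δ) (meshDomainFinset Ω δ) criticalBetaTwo 0
        BoundaryCondition.free (nearestSite δ z) (nearestSite δ w) / rhoCHI δ := by
  filter_upwards [eventually_nearestSite_mem_meshInteriorFinset hM hz,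
    eventually_nearestSite_mem_meshInteriorFinset hM hw, eventually_nearestSite_ne hzw] with δ hz' hw' hne
  exact div_le_div_of_nonneg_right
    (meshIsingFreeCorr_two_le_isingTwoPoint_meshDomainFinset hz' hw' hne) (rhoCHI_pos δ).le

/-- **Lower half of `chi_twoPoint_free_jordan` for approximable Jordan domains, from CHI Thms. 1.5,
1.7 and Remark 2.18** (`h₁ h₂ h₃` verbatim the named facts `chi_plusTwoPoint_diagLogDerivative`,
`chi_plusTwoPoint_nnRatio`, `chi_freePlusTwoPoint_ratio` of `PlanarIsingOnePointSplit`): for `Ω` Jordan with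
`MeshApproximates Ω`, `ψ : Ω → ℍ` a conformal bijection, distinct `z, w ∈ Ω` and `ε > 0`,
eventually `⟨σ_zσ_w⟩^free_Ω - ε < 𝔼^free_{Ω_δ, all sites free}[σ_{[z/δ]}σ_{[w/δ]}] / ϱ(δ)`, i.e.
`liminf ≥ ⟨σ_zσ_w⟩^free_Ω`. (CHI §2.9, p. 19, obtain the matching upper bound from the same theorem
on a second approximating family; that half is not derived here.)
[cite: ChelkakHonglerIzyurovAnnals2015, Thm. 1.1 (free boundary conditions), §2.9 p. 19; FriedliVelenik2017, Exercise 3.12] -/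
theorem chi_twoPoint_free_jordan_lowerHalf_of_CHI
    (h₁ : ∀ (Ω : Set ℂ), IsAdmissibleDomain Ω → MeshApproximates Ω → ∀ (φ : ℂ → ℂ),
      IsConformalBijection φ Ω UpperHalfPlane.upperHalfPlaneSet → ∀ x ∈ Ω,
        ∀ K ⊆ Ω \ {x}, IsCompact K → ∀ s ∈ LatticeRatio.diagSteps, ∀ ε > (0 : ℝ), ∀ᶠ δ in 𝓝[>] (0 : ℝ),
          ∀ v : Site 2, meshPoint δ v ∈ K →
            |(meshIsingPlusCorr Ω δ ![x, meshPoint δ (v + s)] / meshIsingPlusCorr Ω δ ![x, meshPoint δ v] - 1) / δ -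
              (ACHI φ (meshPoint δ v) x * Site.toComplex s).re| < ε)
    (h₂ : ∀ (Ω : Set ℂ), IsAdmissibleDomain Ω → MeshApproximates Ω → ∀ (φ : ℂ → ℂ),
      IsConformalBijection φ Ω UpperHalfPlane.upperHalfPlaneSet → ∀ x ∈ Ω,
        ∀ K ⊆ Ω \ {x}, IsCompact K → ∀ s ∈ LatticeRatio.nnSteps, ∀ ε > (0 : ℝ), ∀ᶠ δ in 𝓝[>] (0 : ℝ),
          ∀ v : Site 2, meshPoint δ v ∈ K →
            |meshIsingPlusCorr Ω δ ![x, meshPoint δ (v + s)] / meshIsingPlusCorr Ω δ ![x, meshPoint δ v] - 1| < ε)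
    (h₃ : ∀ (Ω : Set ℂ), IsAdmissibleDomain Ω → MeshApproximates Ω → ∀ (φ : ℂ → ℂ),
      IsConformalBijection φ Ω UpperHalfPlane.upperHalfPlaneSet →
        ∀ x ∈ Ω, ∀ (y : ℝ → ℂ) (y₀ : ℂ), y₀ ∈ Ω → y₀ ≠ x → Tendsto y (𝓝[>] 0) (𝓝 y₀) →
          Tendsto (fun δ => meshIsingFreeCorr Ω δ ![x, y δ] / meshIsingPlusCorr Ω δ ![x, y δ])
            (𝓝[>] 0) (𝓝 (bCHI (φ x) (φ y₀))))
    (Ω : JordanDomain) (hM : MeshApproximates Ω.carrier) {ψ : ℂ → ℂ}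
    (hψ : IsConformalBijection ψ Ω.carrier UpperHalfPlane.upperHalfPlaneSet) {z w : ℂ}
    (hz : z ∈ Ω.carrier) (hw : w ∈ Ω.carrier) (hzw : z ≠ w) {ε : ℝ} (hε : 0 < ε) :
    ∀ᶠ δ in 𝓝[>] (0 : ℝ), twoPointFreeCHI ψ z w - ε <
      isingTwoPoint (discreteDomainGraph Ω.carrier δ) (meshDomainFinset Ω.carrier δ) criticalBetaTwo 0
        BoundaryCondition.free (nearestSite δ z) (nearestSite δ w) / rhoCHI δ := by
  have hT := tendsto_meshIsingFreeCorr_div_rhoCHI_jordan_of_CHI h₁ h₂ h₃ Ω hM hψ hz hw hzw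
  have hlt : twoPointFreeCHI ψ z w - ε < twoPointFreeCHI ψ z w := by linarith
  filter_upwards [hT.eventually_const_lt hlt,
    eventually_meshIsingFreeCorr_div_le_of_meshApproximates hM hz hw hzw] with δ h1 h2
  exact h1.trans_le h2

/-! ### The lattice sandwich between an inner and an outer approximating domain

CHI §2.9 (p. 19): the free two-point function of the fact's model (all sites of `Ω_δ` free) is
compared, by Griffiths' second inequality in the volume AND in the couplings, with the
interior-volume free models `meshIsingFreeCorr` of an inner domain `Ω₀` (`closure Ω₀ ⊆ Ω`) and of
an outer domain `Ω' ⊇ closure Ω`, to which the CHI chain applies when they satisfy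
`MeshApproximates`. The geometric input is the tree's theorem that the largest mesh component of
a Jordan domain is the bulk (`JordanDomain.eventually_forall_mem_meshDomain'`,
`MeshDomainJordan.lean`), valid for every Jordan domain (Osgood curves included). -/

/-- The pair observable: `⟨σ_xσ_y⟩ = ⟨σ_{{x,y}}⟩` for distinct sites, free boundary conditions on
`Ω_δ`. [folklore] -/
theorem isingTwoPoint_free_eq_isingCorr_pair {Ω : Set ℂ} {δ : ℝ} (Λ : Finset (Site 2))
    {x y : Site 2} (h : x ≠ y) :
    isingTwoPoint (discreteDomainGraph Ω δ) Λ criticalBetaTwo 0 BoundaryCondition.free x y =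
      isingCorr (discreteDomainGraph Ω δ) Λ criticalBetaTwo 0 BoundaryCondition.free {x, y} := by
  unfold isingTwoPoint isingCorr
  congr 1
  funext s
  simp [spinPair, spinProduct, Finset.prod_pair h]

/-- **Monotonicity of the graph `Ω_δ` in the domain**, given the inclusion of the site sets: if
`closure Ω ⊆ closure Ω'` and `meshDomain Ω δ ⊆ meshDomain Ω' δ`, every bond of `Ω_δ` (a lattice
edge between sites of `Ω_δ` whose closed segment stays in `Ω̄`) is a bond of `Ω'_δ`. [folklore] -/
theorem discreteDomainGraph_le_of_subset {Ω Ω' : Set ℂ} {δ : ℝ} (hcl : closure Ω ⊆ closure Ω')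
    (hD : meshDomain Ω δ ⊆ meshDomain Ω' δ) : discreteDomainGraph Ω δ ≤ discreteDomainGraph Ω' δ := by
  intro x y hxy
  rw [discreteDomainGraph_adj_iff] at hxy ⊢
  obtain ⟨hm, hx, hy⟩ := hxy
  rw [meshGraph_adj_iff] at hm ⊢
  exact ⟨⟨hm.1, hm.2.trans hcl⟩, hD hx, hD hy⟩

/-- **Marked points round into `Ω_δ` (every Jordan domain)**: for `a ∈ Ω`, eventually the rounded
site `[a/δ]` belongs to the largest component `meshDomain Ω δ` (the bulk theorem
`JordanDomain.eventually_forall_mem_meshDomain'` applied to a closed disc about `a`, which contains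
the mesh point of `[a/δ]` once `δ` is smaller than its radius). [folklore] -/
theorem _root_.Literature.Probability.RandomPlanarGeometry.JordanDomain.eventually_nearestSite_mem_meshDomain (Ω : JordanDomain) {a : ℂ}
    (ha : a ∈ Ω.carrier) : ∀ᶠ δ in 𝓝[>] (0 : ℝ), nearestSite δ a ∈ meshDomain Ω.carrier δ := by
  obtain ⟨r, hr, hball⟩ := Metric.isOpen_iff.1 Ω.isOpen a ha
  have hKΩ : closedBall a (r / 2) ⊆ Ω.carrier := (closedBall_subset_ball (by linarith)).trans hball
  have hev : ∀ᶠ δ in 𝓝[>] (0 : ℝ), δ < r / 2 := mem_nhdsWithin_of_mem_nhds (Iio_mem_nhds (by positivity))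
  filter_upwards [Ω.eventually_forall_mem_meshDomain' (isCompact_closedBall _ _) hKΩ, hev,
    self_mem_nhdsWithin] with δ h hδr hδ
  have hδ0 : (0 : ℝ) < δ := hδ
  refine h.1 _ (mem_closedBall.2 ?_)
  exact (dist_meshPoint_nearestSite_le hδ0 a).trans hδr.le

/-- **Inner inclusion of the discrete domains**: if `closure Ω₀ ⊆ Ω` with `Ω` Jordan, then
eventually `meshDomain Ω₀ δ ⊆ meshDomain Ω δ` (every site of `Ω₀` has its mesh point in the compact
`closure Ω₀ ⊆ Ω`, which the bulk of `Ω_δ` swallows) and hence `(Ω₀)_δ ≤ Ω_δ` as graphs.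
[folklore] -/
theorem _root_.Literature.Probability.RandomPlanarGeometry.JordanDomain.eventually_meshDomain_subset_of_closure_subset (Ω : JordanDomain) {Ω₀ : Set ℂ}
    (h₀ : closure Ω₀ ⊆ Ω.carrier) :
    ∀ᶠ δ in 𝓝[>] (0 : ℝ), meshDomain Ω₀ δ ⊆ meshDomain Ω.carrier δ ∧
      discreteDomainGraph Ω₀ δ ≤ discreteDomainGraph Ω.carrier δ := by
  have hb : Bornology.IsBounded Ω₀ := Ω.isBounded.subset (subset_closure.trans h₀)
  filter_upwards [Ω.eventually_forall_mem_meshDomain' hb.isCompact_closure h₀] with δ h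
  have hD : meshDomain Ω₀ δ ⊆ meshDomain Ω.carrier δ := fun x hx =>
    h.1 x (subset_closure (meshDomain_subset_meshVertices Ω₀ δ hx))
  exact ⟨hD, discreteDomainGraph_le_of_subset (h₀.trans subset_closure) hD⟩

/-- **Outer inclusion of the discrete domains**: if `closure Ω ⊆ Ω'` with `Ω` bounded and the
discretisations of `Ω'` approximate it (`MeshApproximates Ω'`, bulk clause), then eventually every
site of `Ω_δ` is an INTERIOR (free) site of `Ω'_δ` and `Ω_δ ≤ Ω'_δ` as graphs. [folklore] -/
theorem eventually_meshDomain_subset_meshInteriorFinset_of_closure_subset {Ω Ω' : Set ℂ}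
    (hb : Bornology.IsBounded Ω) (hM' : MeshApproximates Ω') (h' : closure Ω ⊆ Ω') :
    ∀ᶠ δ in 𝓝[>] (0 : ℝ), meshDomain Ω δ ⊆ ↑(meshInteriorFinset Ω' δ) ∧
      discreteDomainGraph Ω δ ≤ discreteDomainGraph Ω' δ := by
  filter_upwards [hM'.2.2 _ hb.isCompact_closure h', self_mem_nhdsWithin] with δ hK hδ
  have hδ0 : (0 : ℝ) < δ := hδ
  have hI : meshDomain Ω δ ⊆ ↑(meshInteriorFinset Ω' δ) := fun x hx =>
    mem_of_mem_meshPolygon hδ0 (hK (subset_closure (meshDomain_subset_meshVertices Ω δ hx)))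
      (meshPoint_mem_meshCell hδ0.le x)
  refine ⟨hI, discreteDomainGraph_le_of_subset (h'.trans subset_closure) (hI.trans fun x hx => ?_)⟩
  have hx' := Finset.mem_coe.2 (meshInteriorFinset_subset_meshDomainFinset Ω' δ hx)
  by_cases hb' : Bornology.IsBounded Ω'
  · rwa [coe_meshDomainFinset hb' hδ0] at hx'
  · simp [meshDomainFinset, hb'] at hx'

/-- **Lower lattice sandwich** (GKS II in the volume and in the couplings, Friedli–Velenik
Exercises 3.12 and 3.31, as in CHI §2.9): for `Ω` Jordan, an inner domain `Ω₀` with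
`closure Ω₀ ⊆ Ω` whose discretisations approximate it, and distinct `z, w ∈ Ω₀`, eventually
`𝔼^free_{(Ω₀)_δ, interior sites}[σ_zσ_w] ≤ 𝔼^free_{Ω_δ, all sites}[σ_zσ_w]`.
[cite: FriedliVelenik2017, Exercises 3.12 and 3.31] -/
theorem eventually_meshIsingFreeCorr_inner_le (Ω : JordanDomain) {Ω₀ : Set ℂ}
    (hM₀ : MeshApproximates Ω₀) (h₀ : closure Ω₀ ⊆ Ω.carrier) {z w : ℂ} (hz : z ∈ Ω₀) (hw : w ∈ Ω₀)
    (hzw : z ≠ w) :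
    ∀ᶠ δ in 𝓝[>] (0 : ℝ), meshIsingFreeCorr Ω₀ δ ![z, w] ≤
      isingTwoPoint (discreteDomainGraph Ω.carrier δ) (meshDomainFinset Ω.carrier δ) criticalBetaTwo 0
        BoundaryCondition.free (nearestSite δ z) (nearestSite δ w) := by
  have hb₀ : Bornology.IsBounded Ω₀ := Ω.isBounded.subset (subset_closure.trans h₀)
  filter_upwards [Ω.eventually_meshDomain_subset_of_closure_subset h₀,
    eventually_nearestSite_mem_meshInteriorFinset hM₀ hz,
    eventually_nearestSite_mem_meshInteriorFinset hM₀ hw, eventually_nearestSite_ne hzw,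
    self_mem_nhdsWithin] with δ hDG hz' hw' hne hδ
  have hδ0 : (0 : ℝ) < δ := hδ
  -- the volumes: interior sites of `(Ω₀)_δ` ⊆ all sites of `Ω_δ`
  have hΛ : meshInteriorFinset Ω₀ δ ⊆ meshDomainFinset Ω.carrier δ := by
    intro x hx
    have hx' : x ∈ meshDomain Ω₀ δ := by
      have := meshInteriorFinset_subset_meshDomainFinset Ω₀ δ hx
      rwa [← Finset.mem_coe, coe_meshDomainFinset hb₀ hδ0] at this
    rw [← Finset.mem_coe, coe_meshDomainFinset Ω.isBounded hδ0]
    exact hDG.1 hx'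
  have hA : ({nearestSite δ z, nearestSite δ w} : Finset (Site 2)) ⊆ meshInteriorFinset Ω₀ δ := by
    intro x hx
    simp only [Finset.mem_insert, Finset.mem_singleton] at hx
    rcases hx with rfl | rfl
    · exact hz'
    · exact hw'
  rw [meshIsingFreeCorr_two_eq Ω₀ δ hne, isingTwoPoint_free_eq_isingCorr_pair _ hne]
  calc isingCorr (discreteDomainGraph Ω₀ δ) (meshInteriorFinset Ω₀ δ) criticalBetaTwo 0 .free
        {nearestSite δ z, nearestSite δ w}
      ≤ isingCorr (discreteDomainGraph Ω₀ δ) (meshDomainFinset Ω.carrier δ) criticalBetaTwo 0 .free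
        {nearestSite δ z, nearestSite δ w} :=
        isingCorr_free_le_of_subset _ criticalBetaTwo_pos.le le_rfl hA hΛ
    _ ≤ isingCorr (discreteDomainGraph Ω.carrier δ) (meshDomainFinset Ω.carrier δ) criticalBetaTwo 0
        .free {nearestSite δ z, nearestSite δ w} :=
        isingCorr_free_mono_graph (fun Λ A B β h bc => GKSInequalities.gks_two_holds _) hDG.2
          criticalBetaTwo_pos.le le_rfl (hA.trans hΛ)

/-- **Upper lattice sandwich** (GKS II in the volume and in the couplings): for `Ω` Jordan, an
outer domain `Ω' ⊇ closure Ω` whose discretisations approximate it, and distinct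
`z, w ∈ Ω`, eventually `𝔼^free_{Ω_δ, all sites}[σ_zσ_w] ≤ 𝔼^free_{Ω'_δ, interior sites}[σ_zσ_w]`
(the marked sites lie in `Ω_δ` by the bulk theorem for `Ω`).
[cite: FriedliVelenik2017, Exercises 3.12 and 3.31] -/
theorem eventually_le_meshIsingFreeCorr_outer (Ω : JordanDomain) {Ω' : Set ℂ}
    (hM' : MeshApproximates Ω') (h' : closure Ω.carrier ⊆ Ω')
    {z w : ℂ} (hz : z ∈ Ω.carrier) (hw : w ∈ Ω.carrier) (hzw : z ≠ w) :
    ∀ᶠ δ in 𝓝[>] (0 : ℝ),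
      isingTwoPoint (discreteDomainGraph Ω.carrier δ) (meshDomainFinset Ω.carrier δ) criticalBetaTwo 0
        BoundaryCondition.free (nearestSite δ z) (nearestSite δ w) ≤ meshIsingFreeCorr Ω' δ ![z, w] := by
  filter_upwards [eventually_meshDomain_subset_meshInteriorFinset_of_closure_subset Ω.isBounded hM' h',
    Ω.eventually_nearestSite_mem_meshDomain hz, Ω.eventually_nearestSite_mem_meshDomain hw,
    eventually_nearestSite_ne hzw, self_mem_nhdsWithin] with δ hDG hz' hw' hne hδ
  have hδ0 : (0 : ℝ) < δ := hδ
  have hΛ : meshDomainFinset Ω.carrier δ ⊆ meshInteriorFinset Ω' δ := by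
    intro x hx
    rw [← Finset.mem_coe, coe_meshDomainFinset Ω.isBounded hδ0] at hx
    exact hDG.1 hx
  have hA : ({nearestSite δ z, nearestSite δ w} : Finset (Site 2)) ⊆ meshDomainFinset Ω.carrier δ := by
    intro x hx
    rw [← Finset.mem_coe, coe_meshDomainFinset Ω.isBounded hδ0]
    simp only [Finset.mem_insert, Finset.mem_singleton] at hx
    rcases hx with rfl | rfl
    · exact hz'
    · exact hw'
  rw [meshIsingFreeCorr_two_eq Ω' δ hne, isingTwoPoint_free_eq_isingCorr_pair _ hne]
  calc isingCorr (discreteDomainGraph Ω.carrier δ) (meshDomainFinset Ω.carrier δ) criticalBetaTwo 0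
        .free {nearestSite δ z, nearestSite δ w}
      ≤ isingCorr (discreteDomainGraph Ω.carrier δ) (meshInteriorFinset Ω' δ) criticalBetaTwo 0 .free
        {nearestSite δ z, nearestSite δ w} :=
        isingCorr_free_le_of_subset _ criticalBetaTwo_pos.le le_rfl hA hΛ
    _ ≤ isingCorr (discreteDomainGraph Ω' δ) (meshInteriorFinset Ω' δ) criticalBetaTwo 0 .free
        {nearestSite δ z, nearestSite δ w} :=
        isingCorr_free_mono_graph (fun Λ A B β h bc => GKSInequalities.gks_two_holds _) hDG.2
          criticalBetaTwo_pos.le le_rfl (hA.trans hΛ)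

/-! ### CHI Thm 1.1 (free) for the fact's model, from CHI for approximating inner and outer domains -/

/-- **Squeeze.** Let `Ω` be Jordan, `z ≠ w` in `Ω`, `T ∈ ℝ`. Suppose that for every `ε > 0` there
are an inner domain `Ω₀` (`closure Ω₀ ⊆ Ω`, `z, w ∈ Ω₀`, `MeshApproximates Ω₀`) whose interior-volume
quotient `𝔼^free_{(Ω₀)_δ}[σ_zσ_w]/ϱ(δ)` tends to some `T₀ > T - ε`, and an outer domain `Ω'`
(`closure Ω ⊆ Ω'`, `MeshApproximates Ω'`) whose quotient tends to some `T' < T + ε`. Then the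
quotient of the fact's model (all sites of `Ω_δ` free) tends to `T` (lattice sandwich + squeeze).
[cite: ChelkakHonglerIzyurovAnnals2015, §2.9 p. 19 ("independent of the particular choice of lattice approximations")] -/
theorem _root_.Literature.Probability.RandomPlanarGeometry.JordanDomain.tendsto_isingTwoPoint_free_div_rhoCHI_of_sandwich (Ω : JordanDomain) {z w : ℂ}
    (hz : z ∈ Ω.carrier) (hw : w ∈ Ω.carrier) (hzw : z ≠ w) {T : ℝ}
    (hinner : ∀ ε > (0 : ℝ), ∃ (Ω₀ : Set ℂ) (T₀ : ℝ), MeshApproximates Ω₀ ∧ closure Ω₀ ⊆ Ω.carrier ∧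
      z ∈ Ω₀ ∧ w ∈ Ω₀ ∧ T - ε < T₀ ∧
      Tendsto (fun δ => meshIsingFreeCorr Ω₀ δ ![z, w] / rhoCHI δ) (𝓝[>] 0) (𝓝 T₀))
    (houter : ∀ ε > (0 : ℝ), ∃ (Ω' : Set ℂ) (T' : ℝ), MeshApproximates Ω' ∧
      closure Ω.carrier ⊆ Ω' ∧ T' < T + ε ∧
      Tendsto (fun δ => meshIsingFreeCorr Ω' δ ![z, w] / rhoCHI δ) (𝓝[>] 0) (𝓝 T')) :
    Tendsto (fun δ : ℝ => isingTwoPoint (discreteDomainGraph Ω.carrier δ)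
        (meshDomainFinset Ω.carrier δ) criticalBetaTwo 0 BoundaryCondition.free
        (nearestSite δ z) (nearestSite δ w) / rhoCHI δ) (𝓝[>] 0) (𝓝 T) := by
  rw [Metric.tendsto_nhds]
  intro ε hε
  obtain ⟨Ω₀, T₀, hM₀, h₀, hz₀, hw₀, hT₀, hlim₀⟩ := hinner ε hε
  obtain ⟨Ω', T', hM', h', hT', hlim'⟩ := houter ε hε
  filter_upwards [eventually_meshIsingFreeCorr_inner_le Ω hM₀ h₀ hz₀ hw₀ hzw,
    eventually_le_meshIsingFreeCorr_outer Ω hM' h' hz hw hzw,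
    hlim₀.eventually_const_lt hT₀, hlim'.eventually_lt_const hT'] with δ hlo hup h1 h2
  rw [Real.dist_eq, abs_sub_lt_iff]
  have hρ := rhoCHI_pos δ
  constructor
  · have := div_le_div_of_nonneg_right hup hρ.le
    linarith
  · have := div_le_div_of_nonneg_right hlo hρ.le
    linarith

/-- **CHI Theorem 1.1 (free boundary conditions) for the fact's model, from CHI Thm 1.1 (free) in
its interior-volume form on approximable domains plus the existence of approximable inner/outer
approximants.** Hypotheses: `hT` — the conclusion of the tree's assembly
`(chi_twoPoint_rho_of_spinorCoefficient h₁ h₂ h₃).2`, i.e. CHI Thm 1.1 (free, `ϱ`-normalised,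
pointwise) for every admissible `Ω` with `MeshApproximates Ω`, for the free model on the interior
sites; `happrox` — for a Jordan `Ω`, a chart `ψ : Ω → ℍ`, distinct `z, w ∈ Ω` and `ε > 0`, inner
and outer admissible approximable domains whose CHI two-point functions `⟨σ_zσ_w⟩^free` are within
`ε` of `⟨σ_zσ_w⟩^free_Ω` (on paper: polygonal approximants and Carathéodory's kernel theorem,
Pommerenke Thm. 1.8, with the covariance (1.2)). Conclusion: the named fact
`chi_twoPoint_free_jordan`. [cite: ChelkakHonglerIzyurovAnnals2015, Thm. 1.1 (free b.c.), §2.9 p. 19] -/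
theorem chi_twoPoint_free_jordan_of_interior_of_approximants
    (hT : ∀ (Ω : Set ℂ), IsAdmissibleDomain Ω → MeshApproximates Ω → ∀ (φ : ℂ → ℂ),
      IsConformalBijection φ Ω UpperHalfPlane.upperHalfPlaneSet → ∀ x ∈ Ω, ∀ y ∈ Ω, x ≠ y →
        Tendsto (fun δ => meshIsingFreeCorr Ω δ ![x, y] / rhoCHI δ) (𝓝[>] 0)
          (𝓝 (twoPointFreeCHI φ x y)))
    (happrox : ∀ (Ω : JordanDomain) (ψ : ℂ → ℂ),
      IsConformalBijection ψ Ω.carrier UpperHalfPlane.upperHalfPlaneSet →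
      ∀ z ∈ Ω.carrier, ∀ w ∈ Ω.carrier, z ≠ w → ∀ ε > (0 : ℝ),
        (∃ (Ω₀ : Set ℂ) (ψ₀ : ℂ → ℂ), IsAdmissibleDomain Ω₀ ∧ MeshApproximates Ω₀ ∧
          closure Ω₀ ⊆ Ω.carrier ∧ z ∈ Ω₀ ∧ w ∈ Ω₀ ∧
          IsConformalBijection ψ₀ Ω₀ UpperHalfPlane.upperHalfPlaneSet ∧
          |twoPointFreeCHI ψ₀ z w - twoPointFreeCHI ψ z w| < ε) ∧
        (∃ (Ω' : Set ℂ) (ψ' : ℂ → ℂ), IsAdmissibleDomain Ω' ∧ MeshApproximates Ω' ∧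
          closure Ω.carrier ⊆ Ω' ∧ IsConformalBijection ψ' Ω' UpperHalfPlane.upperHalfPlaneSet ∧
          |twoPointFreeCHI ψ' z w - twoPointFreeCHI ψ z w| < ε)) :
    chi_twoPoint_free_jordan := by
  intro Ω ψ hψ z hz w hw hzw
  refine Ω.tendsto_isingTwoPoint_free_div_rhoCHI_of_sandwich hz hw hzw (fun ε hε => ?_) (fun ε hε => ?_)
  · obtain ⟨⟨Ω₀, ψ₀, hΩ₀, hM₀, h₀, hz₀, hw₀, hψ₀, hε₀⟩, -⟩ := happrox Ω ψ hψ z hz w hw hzw ε hε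
    refine ⟨Ω₀, twoPointFreeCHI ψ₀ z w, hM₀, h₀, hz₀, hw₀, ?_, hT Ω₀ hΩ₀ hM₀ ψ₀ hψ₀ z hz₀ w hw₀ hzw⟩
    have := (abs_sub_lt_iff.1 hε₀).2
    linarith
  · obtain ⟨-, ⟨Ω', ψ', hΩ', hM', h', hψ', hε'⟩⟩ := happrox Ω ψ hψ z hz w hw hzw ε hε
    refine ⟨Ω', twoPointFreeCHI ψ' z w, hM', h', ?_,
      hT Ω' hΩ' hM' ψ' hψ' z (h' (subset_closure hz)) w (h' (subset_closure hw)) hzw⟩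
    have := (abs_sub_lt_iff.1 hε').1
    linarith

/-! ### Transport of the explicit two-point function along kernel-convergent approximants -/

/-- **Continuity of CHI's explicit free two-point function in the chart data.** If the values and
derivatives of charts `ψ_n` at `z` and `w` converge to those of `ψ`, with `ψ z, ψ w ∈ ℍ` distinct,
then `⟨σ_zσ_w⟩^free` written through `ψ_n` (eqs. (1.2)–(1.3): an algebraic expression in
`ψz, ψw, |ψ'z|, |ψ'w|`, continuous where `Im ψz, Im ψw > 0`, `ψz ≠ ψw`) converges to the value
through `ψ`. [cite: ChelkakHonglerIzyurovAnnals2015, eqs. (1.2)–(1.3)] -/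
theorem tendsto_twoPointFreeCHI_of_tendsto {ι : Type*} {l : Filter ι} {ψs : ι → ℂ → ℂ} {ψ : ℂ → ℂ}
    {z w : ℂ} (hz : Tendsto (fun n => ψs n z) l (𝓝 (ψ z)))
    (hw : Tendsto (fun n => ψs n w) l (𝓝 (ψ w)))
    (hdz : Tendsto (fun n => deriv (ψs n) z) l (𝓝 (deriv ψ z)))
    (hdw : Tendsto (fun n => deriv (ψs n) w) l (𝓝 (deriv ψ w)))
    (hiz : 0 < (ψ z).im) (hiw : 0 < (ψ w).im) (hne : ψ w ≠ ψ z) :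
    Tendsto (fun n => twoPointFreeCHI (ψs n) z w) l (𝓝 (twoPointFreeCHI ψ z w)) := by
  have hconj : ψ w ≠ (starRingEnd ℂ) (ψ z) := fun h => by
    have h' := congrArg Complex.im h
    rw [Complex.conj_im] at h'
    linarith
  have hu : Tendsto (fun n => uCHI (ψs n z) (ψs n w)) l (𝓝 (uCHI (ψ z) (ψ w))) := by
    unfold uCHI
    refine Tendsto.rpow_const ?_ (Or.inr (by norm_num))
    refine ((hw.sub hz).norm).div ((hw.sub ?_).norm) ?_
    · exact (Complex.continuous_conj.tendsto _).comp hz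
    · exact norm_ne_zero_iff.2 (sub_ne_zero.2 hconj)
  have hu_pos : 0 < uCHI (ψ z) (ψ w) := by
    unfold uCHI
    exact Real.rpow_pos_of_pos
      (div_pos (norm_pos_iff.2 (sub_ne_zero.2 hne)) (norm_pos_iff.2 (sub_ne_zero.2 hconj))) _
  unfold twoPointFreeCHI
  refine (Tendsto.div ?_ ?_ ?_).mul ?_
  · exact (Real.continuous_sqrt.tendsto _).comp ((hu.inv₀ hu_pos.ne').sub hu)
  · exact ((((Complex.continuous_im.tendsto _).comp hz).const_mul 2).rpow_const
        (Or.inr (by norm_num))).mul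
      ((((Complex.continuous_im.tendsto _).comp hw).const_mul 2).rpow_const (Or.inr (by norm_num)))
  · exact (mul_pos (Real.rpow_pos_of_pos (by linarith) _) (Real.rpow_pos_of_pos (by linarith) _)).ne'
  · exact (hdz.norm.rpow_const (Or.inr (by norm_num))).mul (hdw.norm.rpow_const (Or.inr (by norm_num)))

/-- A set contained in a closed disc is not the whole plane. [folklore] -/
theorem ne_univ_of_subset_closedBall {S : Set ℂ} {R : ℝ} (hS : S ⊆ closedBall 0 R) : S ≠ univ := by
  intro h
  have h1 := hS (h ▸ mem_univ ((|R| + 1 : ℝ) : ℂ))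
  rw [mem_closedBall, dist_zero_right, Complex.norm_real, Real.norm_eq_abs] at h1
  linarith [le_abs_self R, le_abs_self (|R| + 1)]

/-- **Transport of `⟨σ_zσ_w⟩^free` along kernel-convergent approximants** (Carathéodory kernel
theorem + CHI's covariance (1.2)). Let `Ω` be a Jordan domain, `ψ : Ω → ℍ` a conformal bijection,
`z ≠ w` in `Ω`, and `G_n ⊆ D̄(0, R)` open simply connected sets containing `z` such that (K1) every
compact `K ⊆ Ω` lies in `G_n` for large `n` and (K2) for `p ∉ Ω`, `r > 0`, `D(p, r) ⊄ G_n` for large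
`n`. Then for large `n`: `w ∈ G_n` and some conformal bijection `ψ_n : G_n → ℍ` has
`|⟨σ_zσ_w⟩^free via ψ_n - ⟨σ_zσ_w⟩^free via ψ| < ε`. Proof: Riemann maps `φ_n : G_n → 𝔻`,
`φ : Ω → 𝔻` normalised at `z` (`exists_conformalEquiv_ball_deriv_pos`); `φ_n → φ`, `φ_n' → φ'` at
`z, w` (`CaratheodoryKernel.tendsto_apply`, Pommerenke Thm. 1.8); `ψ_n := ψ ∘ φ⁻¹ ∘ φ_n` is a
conformal bijection `G_n → ℍ` whose values and derivatives at `z, w` converge to those of `ψ`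
(chain rule); conclude by `tendsto_twoPointFreeCHI_of_tendsto`.
[cite: PommerenkeBBCM1992, Thm. 1.8] -/
theorem _root_.Literature.Probability.RandomPlanarGeometry.JordanDomain.eventually_exists_chart_close_of_kernel
    (Ω : JordanDomain) {ψ : ℂ → ℂ}
    (hψ : IsConformalBijection ψ Ω.carrier UpperHalfPlane.upperHalfPlaneSet) {z w : ℂ}
    (hz : z ∈ Ω.carrier) (hw : w ∈ Ω.carrier) (hzw : z ≠ w) (G : ℕ → Set ℂ)
    (hGo : ∀ n, IsOpen (G n)) (hGsc : ∀ n, IsSimplyConnected (G n)) {R : ℝ}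
    (hR : ∀ n, G n ⊆ closedBall 0 R) (hzG : ∀ n, z ∈ G n)
    (hK1 : ∀ K, IsCompact K → K ⊆ Ω.carrier → ∀ᶠ n in atTop, K ⊆ G n)
    (hK2 : ∀ p ∉ Ω.carrier, ∀ r > 0, ∀ᶠ n in atTop, ¬ ball p r ⊆ G n) {ε : ℝ} (hε : 0 < ε) :
    ∀ᶠ n in atTop, w ∈ G n ∧ ∃ ψn : ℂ → ℂ,
      IsConformalBijection ψn (G n) UpperHalfPlane.upperHalfPlaneSet ∧
        |twoPointFreeCHI ψn z w - twoPointFreeCHI ψ z w| < ε := by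
  classical
  -- normalised Riemann maps
  obtain ⟨φlim, h0lim, hdlim_re, hdlim_im⟩ := exists_conformalEquiv_ball_deriv_pos Ω.isOpen
    Ω.isSimplyConnected_carrier Ω.carrier_ne_univ hz
  have hex : ∀ n, ∃ φ : ConformalEquiv (G n) (ball 0 1), φ z = 0 ∧ 0 < (deriv φ z).re ∧
      (deriv φ z).im = 0 := fun n =>
    exists_conformalEquiv_ball_deriv_pos (hGo n) (hGsc n) (ne_univ_of_subset_closedBall (hR n))
      (hzG n)
  choose φ h0 hd_re hd_im using hex
  have hker := fun x (hx : x ∈ Ω.carrier) =>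
    CaratheodoryKernel.tendsto_apply (G := G) hGo Ω.isOpen Ω.isConnected.isPreconnected hR hK1 hK2
      φ φlim hzG hz h0 h0lim (fun n => ⟨hd_re n, hd_im n⟩) ⟨hdlim_re, hdlim_im⟩ hx
  -- the charts `ψ_n = Λ ∘ φ_n`, `Λ = ψ ∘ φlim⁻¹ : 𝔻 → ℍ`
  set Λ : ℂ → ℂ := fun u => ψ (φlim.symm u) with hΛ
  have hΛd : DifferentiableOn ℂ Λ (ball 0 1) :=
    hψ.1.comp φlim.symm.differentiableOn φlim.symm.mapsTo
  have hΛb : BijOn Λ (ball 0 1) UpperHalfPlane.upperHalfPlaneSet := hψ.2.comp φlim.symm.bijOn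
  have hΛc : ∀ u ∈ ball (0 : ℂ) 1, DifferentiableAt ℂ Λ u := fun u hu =>
    hΛd.differentiableAt (isOpen_ball.mem_nhds hu)
  have hΛ'c : ContinuousOn (deriv Λ) (ball 0 1) := (hΛd.analyticOnNhd isOpen_ball).deriv.continuousOn
  have hΛφ : ∀ x ∈ Ω.carrier, Λ (φlim x) = ψ x := fun x hx => by
    simp only [hΛ, φlim.symm_apply_apply hx]
  set ψs : ℕ → ℂ → ℂ := fun n x => Λ (φ n x) with hψs
  have hconf : ∀ n, IsConformalBijection (ψs n) (G n) UpperHalfPlane.upperHalfPlaneSet := fun n =>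
    ⟨hΛd.comp (φ n).differentiableOn (φ n).mapsTo, hΛb.comp (φ n).bijOn⟩
  -- values and derivatives of `ψ_n` at a point `x ∈ Ω` converge to those of `ψ`
  have hconv : ∀ x ∈ Ω.carrier, Tendsto (fun n => ψs n x) atTop (𝓝 (ψ x)) ∧
      Tendsto (fun n => deriv (ψs n) x) atTop (𝓝 (deriv ψ x)) := by
    intro x hx
    obtain ⟨hval, hder⟩ := hker x hx
    have hφx : φlim x ∈ ball (0 : ℂ) 1 := φlim.mapsTo hx
    have hxn : ∀ᶠ n in atTop, x ∈ G n := by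
      filter_upwards [hK1 _ isCompact_singleton (singleton_subset_iff.2 hx)] with n hn
      exact hn (mem_singleton x)
    constructor
    · have h1 : Tendsto (fun n => Λ (φ n x)) atTop (𝓝 (Λ (φlim x))) :=
        ((hΛc _ hφx).continuousAt.tendsto).comp hval
      rwa [hΛφ x hx] at h1
    · -- chain rule for `ψ_n` (eventually, when `x ∈ G n`) and for `Λ ∘ φlim = ψ` near `x`
      have hchain : ∀ᶠ n in atTop, deriv (ψs n) x = deriv Λ (φ n x) * deriv (φ n) x := by
        filter_upwards [hxn] with n hn
        exact deriv_comp x (hΛc _ ((φ n).mapsTo hn))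
          (((φ n).differentiableOn x hn).differentiableAt ((hGo n).mem_nhds hn))
      have hlimchain : deriv ψ x = deriv Λ (φlim x) * deriv φlim x := by
        have h1 : ψ =ᶠ[𝓝 x] fun y => Λ (φlim y) :=
          Filter.eventuallyEq_of_mem (Ω.isOpen.mem_nhds hx) fun y hy => (hΛφ y hy).symm
        rw [h1.deriv_eq]
        exact deriv_comp x (hΛc _ hφx)
          ((φlim.differentiableOn x hx).differentiableAt (Ω.isOpen.mem_nhds hx))
      have h2 : Tendsto (fun n => deriv Λ (φ n x)) atTop (𝓝 (deriv Λ (φlim x))) := by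
        refine (hΛ'c _ hφx).tendsto.comp (tendsto_nhdsWithin_iff.2 ⟨hval, ?_⟩)
        filter_upwards [hxn] with n hn using (φ n).mapsTo hn
      rw [hlimchain]
      exact (h2.mul hder).congr' (hchain.mono fun n hn => hn.symm)
  obtain ⟨hvz, hdz⟩ := hconv z hz
  obtain ⟨hvw, hdw⟩ := hconv w hw
  have hiz : 0 < (ψ z).im := hψ.2.mapsTo hz
  have hiw : 0 < (ψ w).im := hψ.2.mapsTo hw
  have hne : ψ w ≠ ψ z := fun h => hzw (hψ.2.injOn hz hw h.symm)
  have hT := tendsto_twoPointFreeCHI_of_tendsto hvz hvw hdz hdw hiz hiw hne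
  have hwn : ∀ᶠ n in atTop, w ∈ G n := by
    filter_upwards [hK1 _ isCompact_singleton (singleton_subset_iff.2 hw)] with n hn
    exact hn (mem_singleton w)
  filter_upwards [hwn, Metric.tendsto_nhds.1 hT ε hε] with n hn hε'
  exact ⟨hn, ψs n, hconf n, by rwa [Real.dist_eq] at hε'⟩

/-! ### The approximation hypothesis `happrox` and the reduction of the fact to CHI's three theorems -/

/-- A sequence `aₙ = a₀ / (n + 2)` of meshes tends to `0` from the right and stays in
`(0, a₀)`. [folklore] -/
theorem tendsto_const_div_add_two {a₀ : ℝ} (ha₀ : 0 < a₀) :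
    Tendsto (fun n : ℕ => a₀ / ((n : ℝ) + 2)) atTop (𝓝[>] (0 : ℝ)) ∧
      ∀ n : ℕ, 0 < a₀ / ((n : ℝ) + 2) ∧ a₀ / ((n : ℝ) + 2) < a₀ := by
  have hpos : ∀ n : ℕ, (0 : ℝ) < (n : ℝ) + 2 := fun n => by positivity
  refine ⟨tendsto_nhdsWithin_iff.2 ⟨?_, Eventually.of_forall fun n => div_pos ha₀ (hpos n)⟩,
    fun n => ⟨div_pos ha₀ (hpos n), ?_⟩⟩
  · exact Tendsto.const_div_atTop (tendsto_natCast_atTop_atTop.atTop_add tendsto_const_nhds) a₀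
  · rw [div_lt_iff₀ (hpos n)]
    have : (1 : ℝ) < (n : ℝ) + 2 := by linarith [n.cast_nonneg (α := ℝ)]
    nlinarith

/-- **The approximation hypothesis `happrox` holds**: for a Jordan domain `Ω`, a conformal chart
`ψ : Ω → ℍ`, distinct `z, w ∈ Ω` and `ε > 0` there are an INNER admissible mesh-approximable
domain `Ω₀` (`closure Ω₀ ⊆ Ω`, `z, w ∈ Ω₀`) and an OUTER one `Ω' ⊇ closure Ω`, with conformal
charts to `ℍ` through which CHI's explicit `⟨σ_zσ_w⟩^free` is within `ε` of `⟨σ_zσ_w⟩^free_Ω`: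
the polyomino approximants `Polyomino.innerApprox Ω z aₙ`, `Polyomino.outerApprox Ω aₙ`
(`aₙ → 0`; `JordanPolyominoApproximants.lean`) satisfy the kernel hypotheses (K1), (K2), so
`JordanDomain.eventually_exists_chart_close_of_kernel` (Carathéodory kernel theorem,
Pommerenke Thm. 1.8, and the covariance (1.2)) applies — CHI §2.6/§2.9: the limit does not depend
on the approximating family. [cite: ChelkakHonglerIzyurovAnnals2015, §2.6 and §2.9 (end of proof of Thm. 1.1); PommerenkeBBCM1992, Thm. 1.8] -/
theorem _root_.Literature.Probability.RandomPlanarGeometry.JordanDomain.exists_inner_outer_approximants_close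
    (Ω : JordanDomain) (ψ : ℂ → ℂ)
    (hψ : IsConformalBijection ψ Ω.carrier UpperHalfPlane.upperHalfPlaneSet) (z : ℂ)
    (hz : z ∈ Ω.carrier) (w : ℂ) (hw : w ∈ Ω.carrier) (hzw : z ≠ w) (ε : ℝ) (hε : 0 < ε) :
    (∃ (Ω₀ : Set ℂ) (ψ₀ : ℂ → ℂ), IsAdmissibleDomain Ω₀ ∧ MeshApproximates Ω₀ ∧
        closure Ω₀ ⊆ Ω.carrier ∧ z ∈ Ω₀ ∧ w ∈ Ω₀ ∧
        IsConformalBijection ψ₀ Ω₀ UpperHalfPlane.upperHalfPlaneSet ∧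
        |twoPointFreeCHI ψ₀ z w - twoPointFreeCHI ψ z w| < ε) ∧
      (∃ (Ω' : Set ℂ) (ψ' : ℂ → ℂ), IsAdmissibleDomain Ω' ∧ MeshApproximates Ω' ∧
        closure Ω.carrier ⊆ Ω' ∧ IsConformalBijection ψ' Ω' UpperHalfPlane.upperHalfPlaneSet ∧
        |twoPointFreeCHI ψ' z w - twoPointFreeCHI ψ z w| < ε) := by
  obtain ⟨R, hR0, hR, -⟩ := Polyomino.exists_closedBall_and_far Ω.isBounded.closure
  have hRΩ : Ω.carrier ⊆ closedBall 0 R := subset_closure.trans hR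
  constructor
  · -- INNER approximants `Gₙ = innerApprox Ω z aₙ`, `aₙ = a₀/(n+2)` with `a₀` so small that the
    -- cell of `z` lies in `Ω` and `z ∈ Gₙ` for all `n`
    obtain ⟨a₀, ha₀, ha₀P⟩ := mem_nhdsGT_iff_exists_Ioo_subset.1 (Polyomino.eventually_mem_innerApprox Ω hz)
    obtain ⟨ha_t, ha_n⟩ := tendsto_const_div_add_two (mem_Ioi.1 ha₀)
    set a : ℕ → ℝ := fun n => a₀ / ((n : ℝ) + 2) with ha_def
    have hP : ∀ n, z ∈ Polyomino.innerApprox Ω.carrier z (a n) ∧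
        nearestSite (a n) z ∈ Polyomino.cellsIn Ω.carrier (a n) := fun n => ha₀P (ha_n n)
    set G : ℕ → Set ℂ := fun n => Polyomino.innerApprox Ω.carrier z (a n) with hG_def
    have hadm : ∀ n, IsAdmissibleDomain (G n) ∧ MeshApproximates (G n) := fun n =>
      Polyomino.innerApprox_admissible Ω (ha_n n).1 (hP n).2
    have hev := Ω.eventually_exists_chart_close_of_kernel hψ hz hw hzw G
      (fun n => Polyomino.isOpen_innerApprox _ _ _) (fun n => (hadm n).1.2.2.2)
      (fun n => (Polyomino.innerApprox_subset Ω z (ha_n n).1).trans hRΩ) (fun n => (hP n).1)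
      (fun K hK hKΩ => ha_t.eventually (Polyomino.eventually_subset_innerApprox Ω hz hK hKΩ))
      (fun p hp r hr => Eventually.of_forall fun n hsub =>
        hp (Polyomino.innerApprox_subset Ω z (ha_n n).1 (hsub (mem_ball_self hr)))) hε
    obtain ⟨n, hwn, ψn, hψn, hclose⟩ := hev.exists
    exact ⟨G n, ψn, (hadm n).1, (hadm n).2, Polyomino.closure_innerApprox_subset Ω z (ha_n n).1,
      (hP n).1, hwn, hψn, hclose⟩
  · -- OUTER approximants `Gₙ = outerApprox Ω aₙ`, `aₙ = 1/(n+2)`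
    obtain ⟨ha_t, ha_n⟩ := tendsto_const_div_add_two one_pos
    set a : ℕ → ℝ := fun n => 1 / ((n : ℝ) + 2) with ha_def
    set G : ℕ → Set ℂ := fun n => Polyomino.outerApprox Ω.carrier (a n) with hG_def
    have hadm : ∀ n, IsAdmissibleDomain (G n) ∧ MeshApproximates (G n) := fun n =>
      Polyomino.outerApprox_admissible Ω (ha_n n).1
    have hΩG : ∀ n, closure Ω.carrier ⊆ G n := fun n =>
      Polyomino.closure_subset_outerApprox (ha_n n).1 Ω.carrier
    have hev := Ω.eventually_exists_chart_close_of_kernel hψ hz hw hzw G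
      (fun n => Polyomino.isOpen_outerApprox _ _) (fun n => (hadm n).1.2.2.2)
      (fun n => Polyomino.outerApprox_subset_closedBall hR hR0 (ha_n n).1 (ha_n n).2.le)
      (fun n => hΩG n (subset_closure hz))
      (fun K hK hKΩ => Eventually.of_forall fun n => (hKΩ.trans subset_closure).trans (hΩG n))
      (fun p hp r hr => ha_t.eventually (Polyomino.eventually_not_ball_subset_outerApprox Ω hp hr)) hε
    obtain ⟨n, -, ψn, hψn, hclose⟩ := hev.exists
    exact ⟨G n, ψn, (hadm n).1, (hadm n).2, hΩG n, hψn, hclose⟩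

/-- **`chi_twoPoint_free_jordan` from CHI's three deep inputs.** The named fact
`chi_twoPoint_free_jordan` (CHI Thm. 1.1, free boundary conditions, `ϱ`-normalised, for the
canonical discretisation of an arbitrary Jordan domain, all sites free) follows from CHI Thm. 1.5
(`k = 1`), Remark 2.18 and Thm. 1.7 in the tree's form — the hypotheses `h₁`, `h₂`, `h₃` are
VERBATIM the bodies of the named facts `chi_plusTwoPoint_diagLogDerivative`,
`chi_plusTwoPoint_nnRatio`, `chi_freePlusTwoPoint_ratio` (`PlanarIsingOnePointSplit.lean`), so the
fact is discharged by `chi_twoPoint_free_jordan_of_CHI h₁_holds h₂_holds h₃_holds` as soon as they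
are. Assembly: `chi_twoPoint_rho_of_spinorCoefficient` (CHI §2.9 for approximable domains) +
`JordanDomain.exists_inner_outer_approximants_close` (polyomino approximants, Carathéodory kernel
theorem) + `chi_twoPoint_free_jordan_of_interior_of_approximants` (Griffiths sandwich and the bulk
theorem for the largest mesh component). [cite: ChelkakHonglerIzyurovAnnals2015, Thm. 1.1 (free boundary conditions), §2.6, §2.9; via Thm. 1.5, Remark 2.18, Thm. 1.7] -/
theorem chi_twoPoint_free_jordan_of_CHI
    (h₁ : ∀ (Ω : Set ℂ), IsAdmissibleDomain Ω → MeshApproximates Ω → ∀ (φ : ℂ → ℂ),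
      IsConformalBijection φ Ω UpperHalfPlane.upperHalfPlaneSet → ∀ x ∈ Ω,
        ∀ K ⊆ Ω \ {x}, IsCompact K → ∀ s ∈ LatticeRatio.diagSteps, ∀ ε > (0 : ℝ), ∀ᶠ δ in 𝓝[>] (0 : ℝ),
          ∀ v : Site 2, meshPoint δ v ∈ K →
            |(meshIsingPlusCorr Ω δ ![x, meshPoint δ (v + s)] / meshIsingPlusCorr Ω δ ![x, meshPoint δ v] - 1) / δ -
              (ACHI φ (meshPoint δ v) x * Site.toComplex s).re| < ε)
    (h₂ : ∀ (Ω : Set ℂ), IsAdmissibleDomain Ω → MeshApproximates Ω → ∀ (φ : ℂ → ℂ),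
      IsConformalBijection φ Ω UpperHalfPlane.upperHalfPlaneSet → ∀ x ∈ Ω,
        ∀ K ⊆ Ω \ {x}, IsCompact K → ∀ s ∈ LatticeRatio.nnSteps, ∀ ε > (0 : ℝ), ∀ᶠ δ in 𝓝[>] (0 : ℝ),
          ∀ v : Site 2, meshPoint δ v ∈ K →
            |meshIsingPlusCorr Ω δ ![x, meshPoint δ (v + s)] / meshIsingPlusCorr Ω δ ![x, meshPoint δ v] - 1| < ε)
    (h₃ : ∀ (Ω : Set ℂ), IsAdmissibleDomain Ω → MeshApproximates Ω → ∀ (φ : ℂ → ℂ),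
      IsConformalBijection φ Ω UpperHalfPlane.upperHalfPlaneSet →
        ∀ x ∈ Ω, ∀ (y : ℝ → ℂ) (y₀ : ℂ), y₀ ∈ Ω → y₀ ≠ x → Tendsto y (𝓝[>] 0) (𝓝 y₀) →
          Tendsto (fun δ => meshIsingFreeCorr Ω δ ![x, y δ] / meshIsingPlusCorr Ω δ ![x, y δ])
            (𝓝[>] 0) (𝓝 (bCHI (φ x) (φ y₀)))) :
    chi_twoPoint_free_jordan :=
  chi_twoPoint_free_jordan_of_interior_of_approximants (chi_twoPoint_rho_of_spinorCoefficient h₁ h₂ h₃).2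
    JordanDomain.exists_inner_outer_approximants_close

/-- Pointed form: the named fact `chi_twoPoint_free_jordan` follows from the three named facts
`chi_plusTwoPoint_diagLogDerivative`, `chi_plusTwoPoint_nnRatio`, `chi_freePlusTwoPoint_ratio`
(CHI Thm. 1.5 (`k = 1`), Remark 2.18, Thm. 1.7), by unfolding them.
[cite: ChelkakHonglerIzyurovAnnals2015, Thm. 1.1 (free boundary conditions); via Thm. 1.5, Remark 2.18, Thm. 1.7] -/
theorem chi_twoPoint_free_jordan_of_facts (h₁ : chi_plusTwoPoint_diagLogDerivative)
    (h₂ : chi_plusTwoPoint_nnRatio) (h₃ : chi_freePlusTwoPoint_ratio) : chi_twoPoint_free_jordan :=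
  chi_twoPoint_free_jordan_of_CHI h₁ h₂ h₃

end Literature.Probability.LatticeModels
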